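import Summits.PneNP.PneNP.Theorems.ChebyshevTracialDesignGammaDirectionTools
import Literature.Combinatorics.Optimization.ShellLawExcessPinning
import HarnessLib

/-!
# Cell pnp-psdrank, route `ChebyshevTracialDesign`: tools for the PER-MATCHING diagonal excess of the pair-containment form
# (crux `TracialDecayExp20`, stmt-PneNP-19878)

Brick 146a-tools (engine seat g27; eng MEMO-26 §2). In a GENERAL (matching-dependent, not type-constant) direction the pair-containment
form of an `H`-symmetric mask `ψ(|U∩H|)` at a matching `M` exceeds its value at the type-averaged direction by the DIAGONAL EXCESSES of
the three edge classes (lit `ShellLawTypeSortedForms.shellForm_le_typeAvg_add`, prover MEMO-32 §3; M-averaged they are priced by the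
`r = 1` rung, brick 145). PER MATCHING the excess of a class with representative set `R` is — summed over the ordered pairs of the class —
the design value of the nonnegative statistic `ψ(|U∩H|)·n_R(U)·(|R| − n_R(U))`, and Literature `ShellLawExcessPinning` splits its shell sums
into the patterns (`e_v` full, `e_w` EMPTY) and (`e_v` full, `e_w` HALF) on the doubly deleted ground sets `[n] ∖ e_v ∖ e_w`. This file
supplies the three per-matching tools the pricing brick (146a) consumes:

* §1 `shellIn_sdiff_pair_nonempty_of_avoid` — the edge-deleted shell `Shell_{S∖e}(t,c)` is nonempty as soon as `Shell_S(t,c)` is and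
  `t + c < |S|` (Literature `card_shellIn_sdiff_pair_avoid_ratio`: the probability that a given edge is empty is `(|S|−t−c)/|S| > 0`);
* §2 **`abs_fwdDiff_iter_pin10Profile_le`** — level differences of the block-statistic profile on `[n] ∖ e_v ∖ e_w` at the ODD cut `t − 2`
  (one edge full, one edge EMPTY: two edges removed from the ground set, two vertices from the cut; brick 129a's `abs_fwdDiff_iter_subProfile_le`
  with `r = 2`, nonemptiness by one full pin and one empty pin from the shell of `M`);
* §4 (v2) `two_mul_card_reps_le` (`2|R| ≤ n`), `inv_mul_sum_pairs_const_le` (`(n(n−2))⁻¹·Σ_{v∈R}Σ_{w∈R∖v} a ≤ a`, `a ≥ 0`).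
* §3 `sum_eq_card_mul_div`, **`shellAvg_classExcess_eq`** — THE AVERAGED SPLIT at a matching on the full ground set: for an odd cut `t₀+3`
  and an odd level `c₀+1 ≤ t₀+3` with `t₀+3+(c₀+1) ≤ n`, and any set `R` of edge representatives,
  `E_{Shell_{c₀+1}(M)}[ψ(X)·n_R(|R|−n_R)] = ((t₀+2−c₀)(n−t₀−c₀−4)/(n(n−2)))·Σ_{v∈R}Σ_{w∈R∖v} E_{Shell_{[n]∖e_v∖e_w}(t₀+1,c₀+1)}[ψ(X+σ_v)]
     + ((t₀+2−c₀)(c₀+1)/(n(n−2)))·Σ_{v}Σ_{w} (E_{Shell_{[n]∖e_v∖e_w}(t₀,c₀)}[ψ(X+σ_v+[w∈H])] + E_{…}[ψ(X+σ_v+[πw∈H])])`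
  (`σ_v = |e_v∩H|`; the pattern probabilities of `ShellLawExcessPinning` §4): the first weight is a QUADRATIC polynomial of the level with
  value `t(n−t)/(n(n−2))` at the virtual level `c = 0` (`t = t₀+3`), the second carries the factor `c = c₀+1` and VANISHES there.
WHAT THIS FILE DOES NOT DO: price anything (brick 146a), bound the `x`-smoothness numbers, anything on `TracialDecayExp20` itself, psd rank of
P_PM(K_n), or P vs NP. [cite: Rothvoss2017, §2 (PDF p. 6)] [cite: RollinRoss2010, §3 (Lemma 3.1)] [cite: GodsilMeagher2015, §15.2]
Stature: support/instrument (kernel lane, no defs, axioms standard). Supports stmt-PneNP-19878.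
-/

set_option linter.dupNamespace false -- `Summit.PneNP.PneNP.…`: summit = sub-problem (D-0017)

noncomputable section

namespace Summit.PneNP.PneNP.Theorems.ChebyshevTracialDesignDiagonalExcessTools

open Finset Polynomial Literature.Barriers.PneNP Literature.Combinatorics.Optimization
open Literature.Combinatorics.Optimization.ShellStep
open Summit.PneNP.PneNP.Theorems.ChebyshevTracialDesignShellOperatorForm (shell_partner_nonempty)
open Summit.PneNP.PneNP.Theorems.ChebyshevTracialDesignGammaDirectionTools (abs_fwdDiff_iter_subProfile_le)

variable {n : ℕ}

/-! ### §1 Nonemptiness of the edge-deleted shell by an empty pin -/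

/-- **The edge-deleted shell is nonempty by an EMPTY pin**: if `Shell_S(t,c) ≠ ∅` and `t + c < |S|` then `Shell_{S∖e_v}(t,c) ≠ ∅`
(`|S|·|Shell_{S∖e_v}(t,c)| = (|S|−t−c)·|Shell_S(t,c)| > 0`). [cite: Rothvoss2017, §2 (PDF p. 6)] -/
theorem shellIn_sdiff_pair_nonempty_of_avoid {π : Fin n → Fin n} (hπ : ∀ v, π (π v) = v) (hπ' : ∀ v, π v ≠ v)
    {S : Finset (Fin n)} (hS : ∀ u ∈ S, π u ∈ S) {v : Fin n} (hv : v ∈ S) {t c : ℕ}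
    (hne : (shellIn π S t c).Nonempty) (hlt : t + c < S.card) :
    (shellIn π (S \ {v, π v}) t c).Nonempty := by
  have h := card_shellIn_sdiff_pair_avoid_ratio hπ hπ' hS hv t c
  have hlt' : ((t : ℝ) + c) < S.card := by exact_mod_cast hlt
  have hpos : (0 : ℝ) < ((S.card : ℝ) - t - c) * (shellIn π S t c).card :=
    mul_pos (by linarith) (by exact_mod_cast hne.card_pos)
  rw [← h] at hpos
  by_contra hemp
  rw [not_nonempty_iff_eq_empty] at hemp
  rw [hemp, card_empty, Nat.cast_zero, mul_zero] at hpos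
  exact lt_irrefl _ hpos

/-! ### §2 Level differences of the (full, empty) profile -/

/-- **One full edge and one EMPTY edge deleted** (`S = ([n] ∖ e_v) ∖ e_w`, distinct edges, ODD cut `t₀′ + 2k`, odd level `c′ ≤ t₀′`,
`t₀′ + 2k + 2 + (c′ + 2k) + 2 ≤ n`): if every `π`-stable `S′` with `|S′| + 4k + 4 = n` has `Σ_{x=0}^{t₀′+2k} |(∇²)^k law_{S′}(t₀′,·)(c′)(x)| ≤ X`,
then `|Δ^k_{(2)}[c ↦ E_{Shell_S(t₀′+2k,c)}[χ(|W∩H|)]](c′)| ≤ G·ρ^k·X` (`ρ = m/(4(m−2))`); the shell `Shell_S(t₀′+2k, c′+2k)` is nonempty by one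
full pin from the shell of `M` at `(t₀′+2k+2, c′+2k)` and one empty pin (§1). [cite: Rothvoss2017, §2 (PDF p. 6)] [cite: RollinRoss2010, §3 (Lemma 3.1)] -/
theorem abs_fwdDiff_iter_pin10Profile_le (M : PMatch n) {v w : Fin n} (hwv : w ≠ v) (hwπ : w ≠ M.2.partner v)
    (H : Finset (Fin n)) (χ : ℤ → ℝ) {G : ℝ} (hG0 : 0 ≤ G)
    {t₀' k c' m : ℕ} (hG : ∀ x ∈ Icc (0 : ℤ) ((t₀' + 2 * k : ℕ) : ℤ), |χ x| ≤ G)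
    (ht : Odd (t₀' + 2 * k)) (hc : Odd c') (hct : c' ≤ t₀') (hn : t₀' + 2 * k + 2 + (c' + 2 * k) + 2 ≤ n)
    (hm : 3 ≤ m) (hmn : m + 4 * k + 4 ≤ n) {X : ℝ} (hX0 : 0 ≤ X)
    (hX : ∀ S' : Finset (Fin n), (∀ u ∈ S', M.2.partner u ∈ S') → S'.card + 4 * k + 4 = n →
      ∑ x ∈ Icc (0 : ℤ) ((t₀' + 2 * k : ℕ) : ℤ),
        |nab2^[k] (fun c x => shellLaw M.2.partner S' H t₀' c x : Profile) c' x| ≤ X) :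
    |((fwdDiff (2 : ℕ))^[k] (fun c =>
        (∑ W ∈ shellIn M.2.partner ((univ \ {v, M.2.partner v}) \ {w, M.2.partner w}) (t₀' + 2 * k) c,
          χ ((W ∩ H).card : ℤ)) /
        ((shellIn M.2.partner ((univ \ {v, M.2.partner v}) \ {w, M.2.partner w}) (t₀' + 2 * k) c).card : ℝ))) c'| ≤
      G * (((m : ℝ) / (4 * ((m : ℝ) - 2))) ^ k * X) := by
  set π := M.2.partner with hπdef
  have hπ : ∀ v, π (π v) = v := partner_partner M
  have hπ' : ∀ v, π v ≠ v := partner_ne M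
  have hU : ∀ u ∈ (univ : Finset (Fin n)), π u ∈ (univ : Finset (Fin n)) := fun u _ => mem_univ _
  have hS1 : ∀ u ∈ univ \ {v, π v}, π u ∈ univ \ {v, π v} := sdiff_pair_stable hπ hU v
  have hS : ∀ u ∈ (univ \ {v, π v}) \ {w, π w}, π u ∈ (univ \ {v, π v}) \ {w, π w} := sdiff_pair_stable hπ hS1 w
  have hw' : w ∈ (univ : Finset (Fin n)) \ {v, π v} := by
    rw [mem_sdiff, mem_insert, mem_singleton, not_or]; exact ⟨mem_univ _, hwv, hwπ⟩
  have h1 := card_sdiff_pair hπ' hU (mem_univ v)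
  rw [card_univ, Fintype.card_fin] at h1
  have hScard : ((univ \ {v, π v}) \ {w, π w} : Finset (Fin n)).card + 2 * 2 = n := by
    have h2 := card_sdiff_pair hπ' hS1 hw'
    omega
  have hne : (shellIn π ((univ \ {v, π v}) \ {w, π w}) (t₀' + 2 * k) (c' + 2 * k)).Nonempty := by
    refine shellIn_sdiff_pair_nonempty_of_avoid hπ hπ' hS1 hw' ?_ (by omega)
    refine shellIn_sdiff_pair_nonempty_of_full hπ hπ' hU (mem_univ v) ?_ (by omega)
    rw [shellIn_univ]
    exact shell_partner_nonempty M (by obtain ⟨i, hi⟩ := ht; exact ⟨i + 1, by omega⟩)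
      (by obtain ⟨i, hi⟩ := hc; exact ⟨i + k, by omega⟩) (by omega) (by omega)
  exact abs_fwdDiff_iter_subProfile_le M hS hScard H χ hG0 hG hne hm (by omega) hX0 hX

/-! ### §3 The averaged split at a matching -/

/-- `Σ_{W ∈ F} g(W) = |F| · (Σ_{W ∈ F} g(W)) / |F|` (both sides vanish for `F = ∅`). [folklore] -/
theorem sum_eq_card_mul_div {α : Type*} (F : Finset α) (g : α → ℝ) :
    ∑ W ∈ F, g W = (F.card : ℝ) * ((∑ W ∈ F, g W) / (F.card : ℝ)) := by
  by_cases hF : F.card = 0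
  · rw [Finset.card_eq_zero.1 hF]; simp
  · have : (F.card : ℝ) ≠ 0 := by exact_mod_cast hF
    rw [mul_div_cancel₀ _ this]

/-- **THE AVERAGED SPLIT of the class excess at a matching.** For a perfect matching `M` of `[n]` (partner map `π`), a block `H`, a set `R`
of edge representatives (`v < πv` on `R`), `ψ : ℤ → ℝ`, an odd cut `t₀+3` and an odd level `c₀+1 ≤ t₀+3` with `t₀+3+(c₀+1) ≤ n`
(`n_R(U) = #{v ∈ R : v, πv ∈ U}`, `σ_v = |e_v ∩ H|`):
`E_{Shell_{c₀+1}(M)}[ψ(|U∩H|)·n_R(U)(|R|−n_R(U))]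
   = ((t₀+2−c₀)(n−t₀−c₀−4)/(n(n−2)))·Σ_{v∈R}Σ_{w∈R∖v} E_{Shell_{[n]∖e_v∖e_w}(t₀+1,c₀+1)}[ψ(|W∩H|+σ_v)]
   + ((t₀+2−c₀)(c₀+1)/(n(n−2)))·Σ_{v∈R}Σ_{w∈R∖v} (E_{Shell_{[n]∖e_v∖e_w}(t₀,c₀)}[ψ(|W∩H|+σ_v+[w∈H])] + E_{…}[ψ(|W∩H|+σ_v+[πw∈H])])`.
[cite: Rothvoss2017, §2 (PDF p. 6)] [cite: GodsilMeagher2015, §15.2] -/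
theorem shellAvg_classExcess_eq (M : PMatch n) (H : Finset (Fin n)) {R : Finset (Fin n)}
    (hR : ∀ v ∈ R, v < M.2.partner v) (ψ : ℤ → ℝ) {t₀ c₀ : ℕ}
    (ht : Odd (t₀ + 3)) (hc : Odd (c₀ + 1)) (hct : c₀ + 1 ≤ t₀ + 3) (hn : t₀ + 3 + (c₀ + 1) ≤ n) :
    (∑ U ∈ shell M.2.partner (t₀ + 3) (c₀ + 1), ψ ((U ∩ H).card : ℤ) *
        ((((R.filter fun v => v ∈ U ∧ M.2.partner v ∈ U).card : ℕ) : ℝ) *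
          ((R.card : ℝ) - (((R.filter fun v => v ∈ U ∧ M.2.partner v ∈ U).card : ℕ) : ℝ)))) /
        ((shell M.2.partner (t₀ + 3) (c₀ + 1)).card : ℝ) =
      ((((t₀ : ℝ) + 2 - c₀) * ((n : ℝ) - t₀ - c₀ - 4)) / ((n : ℝ) * ((n : ℝ) - 2))) *
        (∑ v ∈ R, ∑ w ∈ R.erase v,
          (∑ W ∈ shellIn M.2.partner ((univ \ {v, M.2.partner v}) \ {w, M.2.partner w}) (t₀ + 1) (c₀ + 1),
            ψ (((W ∩ H).card : ℤ) + ((({v, M.2.partner v} : Finset (Fin n)) ∩ H).card : ℤ))) /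
            ((shellIn M.2.partner ((univ \ {v, M.2.partner v}) \ {w, M.2.partner w}) (t₀ + 1) (c₀ + 1)).card : ℝ)) +
      ((((t₀ : ℝ) + 2 - c₀) * ((c₀ : ℝ) + 1)) / ((n : ℝ) * ((n : ℝ) - 2))) *
        (∑ v ∈ R, ∑ w ∈ R.erase v,
          ((∑ W ∈ shellIn M.2.partner ((univ \ {v, M.2.partner v}) \ {w, M.2.partner w}) t₀ c₀,
              ψ (((W ∩ H).card : ℤ) + ((({v, M.2.partner v} : Finset (Fin n)) ∩ H).card : ℤ) + (if w ∈ H then 1 else 0))) /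
              ((shellIn M.2.partner ((univ \ {v, M.2.partner v}) \ {w, M.2.partner w}) t₀ c₀).card : ℝ) +
            (∑ W ∈ shellIn M.2.partner ((univ \ {v, M.2.partner v}) \ {w, M.2.partner w}) t₀ c₀,
              ψ (((W ∩ H).card : ℤ) + ((({v, M.2.partner v} : Finset (Fin n)) ∩ H).card : ℤ) + (if M.2.partner w ∈ H then 1 else 0))) /
              ((shellIn M.2.partner ((univ \ {v, M.2.partner v}) \ {w, M.2.partner w}) t₀ c₀).card : ℝ))) := by
  classical
  set π := M.2.partner with hπdef
  have hπ : ∀ v, π (π v) = v := partner_partner M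
  have hπ' : ∀ v, π v ≠ v := partner_ne M
  have hU : ∀ u ∈ (univ : Finset (Fin n)), π u ∈ (univ : Finset (Fin n)) := fun u _ => mem_univ _
  have hRS : R ⊆ (univ : Finset (Fin n)) := fun _ _ => mem_univ _
  -- the shell of `M` is nonempty; `n(n−2) ≠ 0`
  have hne : (shell π (t₀ + 3) (c₀ + 1)).Nonempty := shell_partner_nonempty M ht hc hct hn
  have hZ : ((shell π (t₀ + 3) (c₀ + 1)).card : ℝ) ≠ 0 := by
    have := hne.card_pos; positivity
  have hn4 : 4 ≤ n := by omega
  have hnr : (4 : ℝ) ≤ n := by exact_mod_cast hn4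
  have hn0 : (n : ℝ) ≠ 0 := by positivity
  have hn2 : (n : ℝ) - 2 ≠ 0 := (show (0 : ℝ) < (n : ℝ) - 2 by linarith).ne'
  -- the Literature split (on `univ`, cut `t₀ + 3`, level `c₀ + 1`)
  have hsplit := sum_shell_blockStat_classCount_excess_eq hπ hπ' hU H hRS hR t₀ c₀ ψ
  rw [shellIn_univ] at hsplit
  rw [hsplit]
  -- the two pattern probabilities, per ordered pair
  have hratio : ∀ v ∈ R, ∀ w ∈ R.erase v,
      (n : ℝ) * ((n : ℝ) - 2) * (shellIn π ((univ \ {v, π v}) \ {w, π w}) (t₀ + 1) (c₀ + 1)).card =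
        ((t₀ : ℝ) + 2 - c₀) * ((n : ℝ) - t₀ - c₀ - 4) * (shell π (t₀ + 3) (c₀ + 1)).card ∧
      (n : ℝ) * ((n : ℝ) - 2) * (shellIn π ((univ \ {v, π v}) \ {w, π w}) t₀ c₀).card =
        ((t₀ : ℝ) + 2 - c₀) * ((c₀ : ℝ) + 1) * (shell π (t₀ + 3) (c₀ + 1)).card := by
    intro v hv w hw
    have hwR : w ∈ R := (mem_erase.1 hw).2
    have hwv : w ≠ v := (mem_erase.1 hw).1
    have h1 := card_shellIn_full_empty_ratio hπ hπ' hU (mem_univ v) (hR v hv) (mem_univ w) (hR w hwR) hwv t₀ c₀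
    have h2 := card_shellIn_full_half_ratio hπ hπ' hU (mem_univ v) (hR v hv) (mem_univ w) (hR w hwR) hwv t₀ c₀
    rw [card_univ, Fintype.card_fin, shellIn_univ] at h1 h2
    exact ⟨h1, h2⟩
  -- rewrite each pattern sum as (probability × |Shell(M)|) × average
  have hA : ∀ v ∈ R, ∀ w ∈ R.erase v,
      ∑ W ∈ shellIn π ((univ \ {v, π v}) \ {w, π w}) (t₀ + 1) (c₀ + 1),
          ψ (((W ∩ H).card : ℤ) + ((({v, π v} : Finset (Fin n)) ∩ H).card : ℤ)) =
        ((((t₀ : ℝ) + 2 - c₀) * ((n : ℝ) - t₀ - c₀ - 4)) / ((n : ℝ) * ((n : ℝ) - 2))) *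
          ((shell π (t₀ + 3) (c₀ + 1)).card : ℝ) *
          ((∑ W ∈ shellIn π ((univ \ {v, π v}) \ {w, π w}) (t₀ + 1) (c₀ + 1),
              ψ (((W ∩ H).card : ℤ) + ((({v, π v} : Finset (Fin n)) ∩ H).card : ℤ))) /
            ((shellIn π ((univ \ {v, π v}) \ {w, π w}) (t₀ + 1) (c₀ + 1)).card : ℝ)) := by
    intro v hv w hw
    obtain ⟨h1, -⟩ := hratio v hv w hw
    have hcard : ((shellIn π ((univ \ {v, π v}) \ {w, π w}) (t₀ + 1) (c₀ + 1)).card : ℝ) =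
        ((((t₀ : ℝ) + 2 - c₀) * ((n : ℝ) - t₀ - c₀ - 4)) / ((n : ℝ) * ((n : ℝ) - 2))) *
          ((shell π (t₀ + 3) (c₀ + 1)).card : ℝ) := by
      rw [div_mul_eq_mul_div, eq_div_iff (mul_ne_zero hn0 hn2)]
      linear_combination h1
    conv_lhs => rw [sum_eq_card_mul_div]
    rw [hcard]
  have hB : ∀ v ∈ R, ∀ w ∈ R.erase v, ∀ (h : ℤ),
      ∑ W ∈ shellIn π ((univ \ {v, π v}) \ {w, π w}) t₀ c₀,
          ψ (((W ∩ H).card : ℤ) + ((({v, π v} : Finset (Fin n)) ∩ H).card : ℤ) + h) =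
        ((((t₀ : ℝ) + 2 - c₀) * ((c₀ : ℝ) + 1)) / ((n : ℝ) * ((n : ℝ) - 2))) *
          ((shell π (t₀ + 3) (c₀ + 1)).card : ℝ) *
          ((∑ W ∈ shellIn π ((univ \ {v, π v}) \ {w, π w}) t₀ c₀,
              ψ (((W ∩ H).card : ℤ) + ((({v, π v} : Finset (Fin n)) ∩ H).card : ℤ) + h)) /
            ((shellIn π ((univ \ {v, π v}) \ {w, π w}) t₀ c₀).card : ℝ)) := by
    intro v hv w hw h
    obtain ⟨-, h2⟩ := hratio v hv w hw
    have hcard : ((shellIn π ((univ \ {v, π v}) \ {w, π w}) t₀ c₀).card : ℝ) =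
        ((((t₀ : ℝ) + 2 - c₀) * ((c₀ : ℝ) + 1)) / ((n : ℝ) * ((n : ℝ) - 2))) *
          ((shell π (t₀ + 3) (c₀ + 1)).card : ℝ) := by
      rw [div_mul_eq_mul_div, eq_div_iff (mul_ne_zero hn0 hn2)]
      linear_combination h2
    conv_lhs => rw [sum_eq_card_mul_div]
    rw [hcard]
  -- assemble: push the constants through the double sums
  have hpush : ∀ (κ : ℝ) (f : Fin n → Fin n → ℝ),
      ∑ v ∈ R, ∑ w ∈ R.erase v, κ * f v w = κ * ∑ v ∈ R, ∑ w ∈ R.erase v, f v w := by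
    intro κ f
    rw [mul_sum]
    exact sum_congr rfl fun v _ => by rw [mul_sum]
  have eA : ∑ v ∈ R, ∑ w ∈ R.erase v, ∑ W ∈ shellIn π ((univ \ {v, π v}) \ {w, π w}) (t₀ + 1) (c₀ + 1),
        ψ (((W ∩ H).card : ℤ) + ((({v, π v} : Finset (Fin n)) ∩ H).card : ℤ)) =
      (((((t₀ : ℝ) + 2 - c₀) * ((n : ℝ) - t₀ - c₀ - 4)) / ((n : ℝ) * ((n : ℝ) - 2))) *
          ((shell π (t₀ + 3) (c₀ + 1)).card : ℝ)) *
        ∑ v ∈ R, ∑ w ∈ R.erase v,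
          (∑ W ∈ shellIn π ((univ \ {v, π v}) \ {w, π w}) (t₀ + 1) (c₀ + 1),
              ψ (((W ∩ H).card : ℤ) + ((({v, π v} : Finset (Fin n)) ∩ H).card : ℤ))) /
            ((shellIn π ((univ \ {v, π v}) \ {w, π w}) (t₀ + 1) (c₀ + 1)).card : ℝ) := by
    rw [← hpush]
    exact sum_congr rfl fun v hv => sum_congr rfl fun w hw => hA v hv w hw
  have eB : ∀ hh : Fin n → ℤ,
      ∑ v ∈ R, ∑ w ∈ R.erase v, ∑ W ∈ shellIn π ((univ \ {v, π v}) \ {w, π w}) t₀ c₀,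
          ψ (((W ∩ H).card : ℤ) + ((({v, π v} : Finset (Fin n)) ∩ H).card : ℤ) + hh w) =
        (((((t₀ : ℝ) + 2 - c₀) * ((c₀ : ℝ) + 1)) / ((n : ℝ) * ((n : ℝ) - 2))) *
            ((shell π (t₀ + 3) (c₀ + 1)).card : ℝ)) *
          ∑ v ∈ R, ∑ w ∈ R.erase v,
            (∑ W ∈ shellIn π ((univ \ {v, π v}) \ {w, π w}) t₀ c₀,
                ψ (((W ∩ H).card : ℤ) + ((({v, π v} : Finset (Fin n)) ∩ H).card : ℤ) + hh w)) /
              ((shellIn π ((univ \ {v, π v}) \ {w, π w}) t₀ c₀).card : ℝ) := by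
    intro hh
    rw [← hpush]
    exact sum_congr rfl fun v hv => sum_congr rfl fun w hw => hB v hv w hw (hh w)
  have eB1 := eB (fun w => if w ∈ H then 1 else 0)
  have eB2 := eB (fun w => if π w ∈ H then 1 else 0)
  simp only [sum_add_distrib]
  rw [eA, eB1, eB2, mul_add]
  field_simp
  ring

/-! ### §4 Counting the ordered pairs of a representative class (v2) -/

/-- A set of edge representatives has at most `n/2` elements: `2|R| ≤ n` (`R` and `π(R)` are disjoint subsets of `[n]`).
[cite: GodsilMeagher2015, §15.2] -/
theorem two_mul_card_reps_le (M : PMatch n) {R : Finset (Fin n)} (hR : ∀ v ∈ R, v < M.2.partner v) : 2 * R.card ≤ n := by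
  classical
  set π := M.2.partner with hπdef
  have hπ : ∀ v, π (π v) = v := partner_partner M
  have hinj : Set.InjOn π (R : Set (Fin n)) := fun a _ b _ h => by
    have := congrArg π h; rwa [hπ, hπ] at this
  have hdisj : Disjoint R (R.image π) := by
    refine disjoint_left.2 fun u huR huI => ?_
    obtain ⟨v, hvR, hvu⟩ := mem_image.1 huI
    have h1 := hR u huR
    have h2 := hR v hvR
    rw [← hvu, hπ] at h1
    exact lt_asymm h1 h2
  have hcard := card_union_of_disjoint hdisj
  rw [card_image_of_injOn hinj] at hcard
  have hle : (R ∪ R.image π).card ≤ n := by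
    have := card_le_univ (R ∪ R.image π); rwa [Fintype.card_fin] at this
  omega

/-- **Averaging a constant over the ordered pairs of a representative class**: `(n(n−2))⁻¹·Σ_{v∈R}Σ_{w∈R∖v} a ≤ a` for `a ≥ 0`
(`|R|(|R|−1) ≤ (n/2)(n/2−1) = n(n−2)/4`). [cite: GodsilMeagher2015, §15.2] -/
theorem inv_mul_sum_pairs_const_le (M : PMatch n) {R : Finset (Fin n)} (hR : ∀ v ∈ R, v < M.2.partner v) (hn : 3 ≤ n)
    {a : ℝ} (ha : 0 ≤ a) :
    1 / ((n : ℝ) * ((n : ℝ) - 2)) * ∑ v ∈ R, ∑ _w ∈ R.erase v, a ≤ a := by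
  have hRr : 2 * (R.card : ℝ) ≤ n := by exact_mod_cast two_mul_card_reps_le M hR
  have hn3 : (3 : ℝ) ≤ n := by exact_mod_cast hn
  have hnn : (0 : ℝ) < (n : ℝ) * ((n : ℝ) - 2) := mul_pos (by linarith) (by linarith)
  have e : ∑ v ∈ R, ∑ _w ∈ R.erase v, a = (R.card : ℝ) * ((R.card : ℝ) - 1) * a := by
    rw [sum_congr rfl fun v hv => by rw [sum_const, card_erase_of_mem hv, nsmul_eq_mul], sum_const, nsmul_eq_mul]
    rcases Nat.eq_zero_or_pos R.card with h0 | h1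
    · rw [h0]; simp
    · push_cast [Nat.cast_sub h1]; ring
  have hRR : 1 / ((n : ℝ) * ((n : ℝ) - 2)) * ((R.card : ℝ) * ((R.card : ℝ) - 1)) ≤ 1 := by
    rw [div_mul_eq_mul_div, one_mul, div_le_one hnn]
    nlinarith [hRr, Nat.cast_nonneg (α := ℝ) R.card]
  rw [e, ← mul_assoc]
  exact (mul_le_mul_of_nonneg_right hRR ha).trans_eq (one_mul a)

end Summit.PneNP.PneNP.Theorems.ChebyshevTracialDesignDiagonalExcessTools

end
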